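import Literature.NumberTheory.Sieve.SmoothProfileSumsTransfer
import Literature.NumberTheory.Sieve.SmoothLocalBehaviourHTProofs
import HarnessLib

/-!
# Minor-arc bounds for `W`-class profile sums of a free or odd-restricted friable variable

Topic `Literature/NumberTheory/Sieve`, namespace `Literature.NumberTheory.Sieve.SmoothArcs`; a PROVED sequel of
`SmoothProfileSums` / `SmoothProfileSumsTransfer` in the smoothed circle method over the `y`-friable integers
`S(X, y)` ([Harper2016, §5]).  For a `W`-class profile `p_c = Σ_ℓ c_ℓ W_ℓ` (`‖c‖_W = Σ_ℓ ‖c_ℓ‖(1+|ℓ|)³`,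
`profileNorm`) the profile sums `classProfileSum X y m r c θ = Σ_{n ∈ S(X,y), n ≡ r (m)} p_c(n/X) e(nθ)` of a
variable carrying no congruence condition (`m = 1`) or only a parity condition (`m = 2`, `r = 1`) are bounded at
the minor points `θ` of the circle, by instantiating the minor-arc transfer `norm_classProfileSum_one_le` with
the tree's minor-arc bound for the plain smooth-weighted sums `S_w(θ'; X) = Σ_{n ∈ S(X,y)} w(n/X) e(nθ')`
(`norm_smoothWeightSum_le_of_minor`, [Harper2016, Theorem 1 and §5]) on the window `|θ' − θ| ≤ R/x` and the
trivial bound `‖S_w(θ'; X)‖ ≤ Ψ(X, y) = #S(X, y)` elsewhere.  With `α = α(x, y)` (`saddlePoint`),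
`𝓟(x) = x^α ζ(α, y)/√φ₂(α, y)` and the tree's minor-arc majorant

`B(x, R) = C (log x)³ y^{5/2(1−α)} R^{−1/2+3/2(1−α)} 𝓟(x) + 164 (1 + log x)² y² x^{9/10} + 64 x/R³ + 1`:

* `norm_smoothWeightSum_le_card`: `‖S_w(θ; X)‖ ≤ Ψ(X, y)`;
  `card_smoothNumbersUpTo_le_three_mul_saddleSize`: `Ψ(X, y) ≤ 3 𝓟(x)` for `X ≤ x` in Harper's range
  ([HildebrandTenenbaum1986, Thm 1] through `card_smoothNumbersUpTo_two_sided`);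
* `minor_of_abs_sub_le`: a point within `ρ` of a point that is minor at distance `δ + ρ` is minor at distance `δ`;
* `norm_classProfileSum_free_le_of_minor_card` (FREE VARIABLE): in Harper's range (`x ≥ x₀`, `(log x)^8 ≤ y`,
  `log y ≤ ½ (log x)^{1/6}`, `y^{80} ≤ x`), for `x/2 ≤ X ≤ x`, `1 ≤ R ≤ x^{1/10}` and every `θ` with
  `|θ − a/q| > 2R/x` for all `1 ≤ q ≤ R`, `a ∈ ℤ` — RADIUS CONVENTION: moduli `q ≤ R`, distance `2R/x`, twice
  the distance `R/x` of the tree's minor arcs, so that the whole window `|θ' − θ| ≤ R/x` consists of minor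
  points in the tree's sense, while `(R/x · X)³ ≥ R³/8` —
  `‖classProfileSum X y 1 0 c θ‖ ≤ B(x, R) Σ_ℓ ‖c_ℓ‖ + 8 Ψ(X, y) ‖c‖_W / R³`;
  `norm_classProfileSum_free_le_of_minor`: the same with `24 𝓟(x) ‖c‖_W / R³` in place of `8 Ψ(X, y) ‖c‖_W / R³`;
* `norm_classProfileSum_odd_le_of_minor_card`, `norm_classProfileSum_odd_le_of_minor` (ODD VARIABLE, one scale
  `X = x`): by the parity split `classProfileSum X y 2 1 c θ = classProfileSum X y 1 0 c θ −
  classProfileSum (X/2) y 1 0 c (2θ)` (`classProfileSum_two_one`), the second piece being a free sum at the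
  scale `X/2 ∈ [X/2, X]` and the doubled frequency `2θ` — RADIUS CONVENTION: moduli `q ≤ 2R`, distance `2R/X`,
  `1 ≤ R ≤ X^{1/10}` (the even moduli `2q' ≤ 2R` make `2θ` minor for the moduli `q' ≤ R` at distance
  `4R/X ≥ 2R/X`) — `‖classProfileSum X y 2 1 c θ‖ ≤ 2 B(X, R) Σ_ℓ ‖c_ℓ‖ + 16 Ψ(X, y) ‖c‖_W / R³`
  (resp. `… + 48 𝓟(X) ‖c‖_W / R³`).

## References

* A. J. Harper, *Minor arcs, mean values, and restriction theory for exponential sums over smooth numbers*,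
  Compositio Math. 152 (2016) 1121–1158, Theorem 1 and §5 [Harper2016].
* A. Hildebrand, G. Tenenbaum, *On integers free of large prime factors*, Trans. Amer. Math. Soc. 296 (1986)
  265–290, Theorem 1 [HildebrandTenenbaum1986].
-/

noncomputable section

open Finset Real Complex
open scoped FourierTransform

namespace Literature.NumberTheory.Sieve

namespace SmoothArcs

open TwistedWeight Endgame

/-! ### Trivial bounds by the friable count -/

/-- `‖S_w(θ; X)‖ ≤ Ψ(X, y) = #S(X, y)` (each term has norm `≤ 1`: `0 ≤ w ≤ 1` on `[0, 1]`). [folklore] -/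
theorem norm_smoothWeightSum_le_card (X : ℝ) (y : ℕ) (θ : ℝ) :
    ‖smoothWeightSum X y θ‖ ≤ ((Nat.smoothNumbersUpTo ⌊X⌋₊ (y + 1)).card : ℝ) := by
  unfold smoothWeightSum
  calc ‖∑ n ∈ Nat.smoothNumbersUpTo ⌊X⌋₊ (y + 1), (wt (n / X) : ℂ) * (𝐞 ((n : ℝ) * θ) : ℂ)‖
      ≤ ∑ n ∈ Nat.smoothNumbersUpTo ⌊X⌋₊ (y + 1), ‖(wt (n / X) : ℂ) * (𝐞 ((n : ℝ) * θ) : ℂ)‖ := norm_sum_le _ _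
    _ ≤ ∑ n ∈ Nat.smoothNumbersUpTo ⌊X⌋₊ (y + 1), (1 : ℝ) := Finset.sum_le_sum fun n hn => by
        obtain ⟨h0, h1⟩ := div_mem_Ioc_of_mem hn
        rw [norm_mul, Circle.norm_coe, mul_one, Complex.norm_real, Real.norm_eq_abs, abs_of_nonneg (wt_nonneg _)]
        exact wt_le_one h0.le h1
    _ = ((Nat.smoothNumbersUpTo ⌊X⌋₊ (y + 1)).card : ℝ) := by simp

/-- **`Ψ(X, y) ≤ 3 𝓟(x)` for `X ≤ x` in Harper's range** `x ≥ x₀`, `(log x)^8 ≤ y`, `log y ≤ ½ (log x)^{1/6}`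
(`𝓟(x) = x^α ζ(α, y)/√φ₂(α, y)`, `α = α(x, y)`): `Ψ(X, y) ≤ Ψ(x, y)` (`card_smoothNumbersUpTo_mono`) and the upper
half of Hildebrand–Tenenbaum's Theorem 1 (`card_smoothNumbersUpTo_two_sided`), whose range `(log x)^4 ≤ y`,
`log y ≤ (log x)^{1/5}` contains Harper's because `log x ≥ 1`. [cite: HildebrandTenenbaum1986, Theorem 1] -/
theorem card_smoothNumbersUpTo_le_three_mul_saddleSize :
    ∃ x₀ : ℝ, ∀ (x : ℝ) (y : ℕ), x₀ ≤ x → Real.log x ^ 8 ≤ y →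
      Real.log y ≤ 1 / 2 * Real.log x ^ (1 / 6 : ℝ) → ∀ X : ℝ, X ≤ x →
        ((Nat.smoothNumbersUpTo ⌊X⌋₊ (y + 1)).card : ℝ) ≤
          3 * (x ^ saddlePoint x y * (smoothZeta (saddlePoint x y) y / Real.sqrt (saddlePhi₂ (saddlePoint x y) y))) := by
  obtain ⟨x₀, hcard⟩ := card_smoothNumbersUpTo_two_sided
  refine ⟨max x₀ 3, fun x y hx hy8 hylog X hXx => ?_⟩
  have hx₀ : x₀ ≤ x := le_trans (le_max_left _ _) hx
  have hx3 : 3 ≤ x := le_trans (le_max_right _ _) hx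
  have hlog1 : 1 ≤ Real.log x := by
    rw [Real.le_log_iff_exp_le (by linarith)]
    have := Real.exp_one_lt_d9
    linarith
  have hy4 : Real.log x ^ 4 ≤ y := (pow_le_pow_right₀ hlog1 (by norm_num : 4 ≤ 8)).trans hy8
  have hylog' : Real.log y ≤ Real.log x ^ (1 / 5 : ℝ) := by
    have h1 : Real.log x ^ (1 / 6 : ℝ) ≤ Real.log x ^ (1 / 5 : ℝ) :=
      Real.rpow_le_rpow_of_exponent_le hlog1 (by norm_num)
    have h2 : 0 ≤ Real.log x ^ (1 / 6 : ℝ) := by positivity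
    linarith
  obtain ⟨-, hup⟩ := hcard x y hx₀ hy4 hylog'
  rw [mul_div_assoc] at hup
  exact (card_smoothNumbersUpTo_mono hXx y).trans hup

/-! ### Minor points near minor points -/

/-- If `|θ − a/q| > δ + ρ` for all `1 ≤ q ≤ R`, `a ∈ ℤ`, and `|θ' − θ| ≤ ρ`, then `|θ' − a/q| > δ` for the same
`q, a` (triangle inequality). [folklore] -/
theorem minor_of_abs_sub_le {R δ ρ θ θ' : ℝ}
    (hminor : ∀ q : ℕ, 1 ≤ q → (q : ℝ) ≤ R → ∀ a : ℤ, δ + ρ < |θ - a / q|) (hθ' : |θ' - θ| ≤ ρ) :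
    ∀ q : ℕ, 1 ≤ q → (q : ℝ) ≤ R → ∀ a : ℤ, δ < |θ' - a / q| := by
  intro q hq hqR a
  have h1 := hminor q hq hqR a
  have h2 := abs_sub_le θ θ' ((a : ℝ) / q)
  rw [abs_sub_comm θ θ'] at h2
  linarith

/-! ### The free variable (`m = 1`) -/

/-- **Minor-arc bound for the profile sums of a free friable variable.** In Harper's range `x ≥ x₀`,
`(log x)^8 ≤ y`, `log y ≤ ½ (log x)^{1/6}`, `y^{80} ≤ x`, for `x/2 ≤ X ≤ x`, `1 ≤ R ≤ x^{1/10}`, a `W`-class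
profile `c` (`‖c‖_W < ∞`) and every `θ` with `|θ − a/q| > 2R/x` for all `1 ≤ q ≤ R` and all `a ∈ ℤ`:
`‖classProfileSum X y 1 0 c θ‖ ≤ B(x, R) Σ_ℓ ‖c_ℓ‖ + 8 Ψ(X, y) ‖c‖_W / R³` with the tree's minor-arc majorant
`B(x, R) = C (log x)³ y^{5/2(1−α)} R^{−1/2+3/2(1−α)} 𝓟(x) + 164 (1 + log x)² y² x^{9/10} + 64 x/R³ + 1`.
Proof: `norm_classProfileSum_one_le` with `ρ = R/x` — every `θ'` with `|θ' − θ| ≤ R/x` has `|θ' − a/q| > R/x`, so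
`‖S_w(θ'; X)‖ ≤ B(x, R)` by `norm_smoothWeightSum_le_of_minor` — and the trivial bound `Ψ(X, y)`, `(ρX)³ ≥ (R/2)³`.
[cite: Harper2016, Theorem 1 and §5] -/
theorem norm_classProfileSum_free_le_of_minor_card :
    ∃ C x₀ : ℝ, 0 < C ∧ ∀ (x : ℝ) (y : ℕ), x₀ ≤ x → Real.log x ^ 8 ≤ y →
      Real.log y ≤ 1 / 2 * Real.log x ^ (1 / 6 : ℝ) → (y : ℝ) ^ 80 ≤ x → ∀ X : ℝ, x / 2 ≤ X → X ≤ x →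
      ∀ R : ℝ, 1 ≤ R → R ≤ x ^ (1 / 10 : ℝ) →
      ∀ c : ℤ → ℂ, Summable (fun ℓ : ℤ => ‖c ℓ‖ * (1 + |(ℓ : ℝ)|) ^ 3) →
      ∀ θ : ℝ, (∀ q : ℕ, 1 ≤ q → (q : ℝ) ≤ R → ∀ a : ℤ, 2 * R / x < |θ - a / q|) →
        ‖classProfileSum X y 1 0 c θ‖ ≤
          (C * Real.log x ^ 3 * (y : ℝ) ^ (5 / 2 * (1 - saddlePoint x y)) *
              R ^ (-(1 / 2 : ℝ) + 3 / 2 * (1 - saddlePoint x y)) *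
              (x ^ saddlePoint x y * (smoothZeta (saddlePoint x y) y / Real.sqrt (saddlePhi₂ (saddlePoint x y) y))) +
            164 * (1 + Real.log x) ^ 2 * (y : ℝ) ^ 2 * x ^ (9 / 10 : ℝ) + 64 * x / R ^ 3 + 1) * (∑' ℓ : ℤ, ‖c ℓ‖) +
          8 * ((Nat.smoothNumbersUpTo ⌊X⌋₊ (y + 1)).card : ℝ) * profileNorm c / R ^ 3 := by
  obtain ⟨C, x₀, hC, hmain⟩ := norm_smoothWeightSum_le_of_minor
  refine ⟨C, max x₀ 2, hC, fun x y hx hy8 hylog hy80 X hXlo hXhi R hR1 hRx c hc θ hminor => ?_⟩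
  have hx₀ : x₀ ≤ x := le_trans (le_max_left _ _) hx
  have hx2 : 2 ≤ x := le_trans (le_max_right _ _) hx
  have hx0 : 0 < x := by linarith
  have hX0 : 0 < X := by linarith
  have hR0 : 0 < R := by linarith
  have hρ : 0 < R / x := by positivity
  have hminor' : ∀ q : ℕ, 1 ≤ q → (q : ℝ) ≤ R → ∀ a : ℤ, R / x + R / x < |θ - a / q| := by
    intro q hq hqR a
    have e : R / x + R / x = 2 * R / x := by ring
    rw [e]
    exact hminor q hq hqR a
  have h := norm_classProfileSum_one_le hc hX0 y hρ
    (fun θ' hθ' => hmain x y hx₀ hy8 hylog hy80 X hXlo hXhi R hR1 hRx θ' (minor_of_abs_sub_le hminor' hθ'))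
    (fun θ' => norm_smoothWeightSum_le_card X y θ')
  refine h.trans (add_le_add le_rfl ?_)
  -- `(ρ X)³ ≥ (R/2)³`
  have hT : 0 ≤ ((Nat.smoothNumbersUpTo ⌊X⌋₊ (y + 1)).card : ℝ) * profileNorm c :=
    mul_nonneg (Nat.cast_nonneg _) (profileNorm_nonneg c)
  have hρX : R / 2 ≤ R / x * X := by
    rw [div_mul_eq_mul_div, div_le_div_iff₀ two_pos hx0]
    nlinarith
  have h3 : (R / 2) ^ 3 ≤ (R / x * X) ^ 3 := pow_le_pow_left₀ (by positivity) hρX 3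
  calc ((Nat.smoothNumbersUpTo ⌊X⌋₊ (y + 1)).card : ℝ) * profileNorm c / (R / x * X) ^ 3
      ≤ ((Nat.smoothNumbersUpTo ⌊X⌋₊ (y + 1)).card : ℝ) * profileNorm c / (R / 2) ^ 3 :=
        div_le_div_of_nonneg_left hT (by positivity) h3
    _ = 8 * ((Nat.smoothNumbersUpTo ⌊X⌋₊ (y + 1)).card : ℝ) * profileNorm c / R ^ 3 := by
        field_simp
        ring

/-- **Minor-arc bound for the profile sums of a free friable variable, saddle-size form**: as
`norm_classProfileSum_free_le_of_minor_card` with the trivial part `8 Ψ(X, y) ‖c‖_W/R³` replaced by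
`24 𝓟(x) ‖c‖_W/R³` (`Ψ(X, y) ≤ 3 𝓟(x)`, [HildebrandTenenbaum1986, Thm 1]); radius convention: moduli `q ≤ R`,
distance `2R/x`. [cite: Harper2016, Theorem 1 and §5] -/
theorem norm_classProfileSum_free_le_of_minor :
    ∃ C x₀ : ℝ, 0 < C ∧ ∀ (x : ℝ) (y : ℕ), x₀ ≤ x → Real.log x ^ 8 ≤ y →
      Real.log y ≤ 1 / 2 * Real.log x ^ (1 / 6 : ℝ) → (y : ℝ) ^ 80 ≤ x → ∀ X : ℝ, x / 2 ≤ X → X ≤ x →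
      ∀ R : ℝ, 1 ≤ R → R ≤ x ^ (1 / 10 : ℝ) →
      ∀ c : ℤ → ℂ, Summable (fun ℓ : ℤ => ‖c ℓ‖ * (1 + |(ℓ : ℝ)|) ^ 3) →
      ∀ θ : ℝ, (∀ q : ℕ, 1 ≤ q → (q : ℝ) ≤ R → ∀ a : ℤ, 2 * R / x < |θ - a / q|) →
        ‖classProfileSum X y 1 0 c θ‖ ≤
          (C * Real.log x ^ 3 * (y : ℝ) ^ (5 / 2 * (1 - saddlePoint x y)) *
              R ^ (-(1 / 2 : ℝ) + 3 / 2 * (1 - saddlePoint x y)) *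
              (x ^ saddlePoint x y * (smoothZeta (saddlePoint x y) y / Real.sqrt (saddlePhi₂ (saddlePoint x y) y))) +
            164 * (1 + Real.log x) ^ 2 * (y : ℝ) ^ 2 * x ^ (9 / 10 : ℝ) + 64 * x / R ^ 3 + 1) * (∑' ℓ : ℤ, ‖c ℓ‖) +
          24 * (x ^ saddlePoint x y * (smoothZeta (saddlePoint x y) y / Real.sqrt (saddlePhi₂ (saddlePoint x y) y))) *
            profileNorm c / R ^ 3 := by
  obtain ⟨C, x₀, hC, hfree⟩ := norm_classProfileSum_free_le_of_minor_card
  obtain ⟨x₁, hcard⟩ := card_smoothNumbersUpTo_le_three_mul_saddleSize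
  refine ⟨C, max x₀ x₁, hC, fun x y hx hy8 hylog hy80 X hXlo hXhi R hR1 hRx c hc θ hminor => ?_⟩
  have hx₀ : x₀ ≤ x := le_trans (le_max_left _ _) hx
  have hx₁ : x₁ ≤ x := le_trans (le_max_right _ _) hx
  have hR0 : 0 < R := by linarith
  refine (hfree x y hx₀ hy8 hylog hy80 X hXlo hXhi R hR1 hRx c hc θ hminor).trans (add_le_add le_rfl ?_)
  have h3 := hcard x y hx₁ hy8 hylog X hXhi
  rw [div_le_div_iff_of_pos_right (pow_pos hR0 3)]
  exact mul_le_mul_of_nonneg_right (by linarith) (profileNorm_nonneg c)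

/-! ### The odd variable (`m = 2`, `r = 1`) -/

/-- **Minor-arc bound for the profile sums of an odd friable variable** (one scale `X`). In Harper's range
`X ≥ x₀`, `(log X)^8 ≤ y`, `log y ≤ ½ (log X)^{1/6}`, `y^{80} ≤ X`, for `1 ≤ R ≤ X^{1/10}`, a `W`-class profile `c`
and every `θ` with `|θ − a/q| > 2R/X` for all `1 ≤ q ≤ 2R` and all `a ∈ ℤ` (moduli up to `2R`):
`‖classProfileSum X y 2 1 c θ‖ ≤ 2 B(X, R) Σ_ℓ ‖c_ℓ‖ + 16 Ψ(X, y) ‖c‖_W / R³`.  Proof: the parity split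
`classProfileSum X y 2 1 c θ = classProfileSum X y 1 0 c θ − classProfileSum (X/2) y 1 0 c (2θ)`
(`classProfileSum_two_one`, `y ≥ 2`) and `norm_classProfileSum_free_le_of_minor_card` twice at `x = X`: at the scale
`X` for `θ` (moduli `q ≤ R ≤ 2R`), and at the scale `X/2` for `2θ`, which is minor for the moduli `q ≤ R` since
`|2θ − a/q| = 2|θ − a/(2q)| > 4R/X` (`2q ≤ 2R`); finally `Ψ(X/2, y) ≤ Ψ(X, y)`. [cite: Harper2016, Theorem 1 and §5] -/
theorem norm_classProfileSum_odd_le_of_minor_card :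
    ∃ C x₀ : ℝ, 0 < C ∧ ∀ (X : ℝ) (y : ℕ), x₀ ≤ X → Real.log X ^ 8 ≤ y →
      Real.log y ≤ 1 / 2 * Real.log X ^ (1 / 6 : ℝ) → (y : ℝ) ^ 80 ≤ X →
      ∀ R : ℝ, 1 ≤ R → R ≤ X ^ (1 / 10 : ℝ) →
      ∀ c : ℤ → ℂ, Summable (fun ℓ : ℤ => ‖c ℓ‖ * (1 + |(ℓ : ℝ)|) ^ 3) →
      ∀ θ : ℝ, (∀ q : ℕ, 1 ≤ q → (q : ℝ) ≤ 2 * R → ∀ a : ℤ, 2 * R / X < |θ - a / q|) →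
        ‖classProfileSum X y 2 1 c θ‖ ≤
          2 * (C * Real.log X ^ 3 * (y : ℝ) ^ (5 / 2 * (1 - saddlePoint X y)) *
              R ^ (-(1 / 2 : ℝ) + 3 / 2 * (1 - saddlePoint X y)) *
              (X ^ saddlePoint X y * (smoothZeta (saddlePoint X y) y / Real.sqrt (saddlePhi₂ (saddlePoint X y) y))) +
            164 * (1 + Real.log X) ^ 2 * (y : ℝ) ^ 2 * X ^ (9 / 10 : ℝ) + 64 * X / R ^ 3 + 1) * (∑' ℓ : ℤ, ‖c ℓ‖) +
          16 * ((Nat.smoothNumbersUpTo ⌊X⌋₊ (y + 1)).card : ℝ) * profileNorm c / R ^ 3 := by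
  obtain ⟨C, x₀, hC, hfree⟩ := norm_classProfileSum_free_le_of_minor_card
  refine ⟨C, max x₀ 4, hC, fun X y hX hy8 hylog hy80 R hR1 hRX c hc θ hminor => ?_⟩
  have hx₀ : x₀ ≤ X := le_trans (le_max_left _ _) hX
  have hX4 : 4 ≤ X := le_trans (le_max_right _ _) hX
  have hX0 : 0 < X := by linarith
  have hR0 : 0 < R := by linarith
  -- `y ≥ 2` (from `(log X)^8 ≤ y`, `X ≥ 4`)
  have hy2 : 2 ≤ y := by
    have hl4 : (1 : ℝ) < Real.log X := by
      have h := Real.log_le_log (by norm_num) hX4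
      have h4 : (1 : ℝ) < Real.log 4 := by
        rw [Real.lt_log_iff_exp_lt (by norm_num)]
        have := Real.exp_one_lt_d9
        linarith
      linarith
    have h1 : (1 : ℝ) < Real.log X ^ 8 := one_lt_pow₀ hl4 (by norm_num)
    have h2 : (1 : ℝ) < y := lt_of_lt_of_le h1 hy8
    exact_mod_cast h2
  -- `θ` is minor for the moduli `q ≤ R`
  have hmin1 : ∀ q : ℕ, 1 ≤ q → (q : ℝ) ≤ R → ∀ a : ℤ, 2 * R / X < |θ - a / q| :=
    fun q hq hqR a => hminor q hq (by linarith) a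
  -- `2θ` is minor for the moduli `q ≤ R`
  have hmin2 : ∀ q : ℕ, 1 ≤ q → (q : ℝ) ≤ R → ∀ a : ℤ, 2 * R / X < |2 * θ - a / q| := by
    intro q hq hqR a
    have h := hminor (2 * q) (by omega) (by push_cast; linarith) a
    have hq0 : (q : ℝ) ≠ 0 := by positivity
    have e : (2 : ℝ) * θ - (a : ℝ) / (q : ℝ) = 2 * (θ - (a : ℝ) / ((2 * q : ℕ) : ℝ)) := by
      push_cast
      field_simp
    rw [e, abs_mul, abs_two]
    have h0 : 0 ≤ 2 * R / X := by positivity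
    linarith [abs_nonneg (θ - (a : ℝ) / ((2 * q : ℕ) : ℝ))]
  have h1 := hfree X y hx₀ hy8 hylog hy80 X (by linarith) le_rfl R hR1 hRX c hc θ hmin1
  have h2 := hfree X y hx₀ hy8 hylog hy80 (X / 2) le_rfl (by linarith) R hR1 hRX c hc (2 * θ) hmin2
  have hcard : ((Nat.smoothNumbersUpTo ⌊X / 2⌋₊ (y + 1)).card : ℝ) ≤
      ((Nat.smoothNumbersUpTo ⌊X⌋₊ (y + 1)).card : ℝ) :=
    card_smoothNumbersUpTo_mono (by linarith) y
  have hkey : 8 * ((Nat.smoothNumbersUpTo ⌊X / 2⌋₊ (y + 1)).card : ℝ) * profileNorm c / R ^ 3 ≤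
      8 * ((Nat.smoothNumbersUpTo ⌊X⌋₊ (y + 1)).card : ℝ) * profileNorm c / R ^ 3 := by
    rw [div_le_div_iff_of_pos_right (pow_pos hR0 3)]
    exact mul_le_mul_of_nonneg_right (by linarith) (profileNorm_nonneg c)
  rw [classProfileSum_two_one hy2]
  refine ((norm_sub_le _ _).trans (add_le_add h1 (h2.trans (add_le_add le_rfl hkey)))).trans (le_of_eq ?_)
  ring

/-- **Minor-arc bound for the profile sums of an odd friable variable, saddle-size form**: as
`norm_classProfileSum_odd_le_of_minor_card` with `16 Ψ(X, y) ‖c‖_W/R³` replaced by `48 𝓟(X) ‖c‖_W/R³`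
(`Ψ(X, y) ≤ 3 𝓟(X)`, [HildebrandTenenbaum1986, Thm 1]); radius convention: moduli `q ≤ 2R`, distance `2R/X`,
`1 ≤ R ≤ X^{1/10}`. [cite: Harper2016, Theorem 1 and §5] -/
theorem norm_classProfileSum_odd_le_of_minor :
    ∃ C x₀ : ℝ, 0 < C ∧ ∀ (X : ℝ) (y : ℕ), x₀ ≤ X → Real.log X ^ 8 ≤ y →
      Real.log y ≤ 1 / 2 * Real.log X ^ (1 / 6 : ℝ) → (y : ℝ) ^ 80 ≤ X →
      ∀ R : ℝ, 1 ≤ R → R ≤ X ^ (1 / 10 : ℝ) →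
      ∀ c : ℤ → ℂ, Summable (fun ℓ : ℤ => ‖c ℓ‖ * (1 + |(ℓ : ℝ)|) ^ 3) →
      ∀ θ : ℝ, (∀ q : ℕ, 1 ≤ q → (q : ℝ) ≤ 2 * R → ∀ a : ℤ, 2 * R / X < |θ - a / q|) →
        ‖classProfileSum X y 2 1 c θ‖ ≤
          2 * (C * Real.log X ^ 3 * (y : ℝ) ^ (5 / 2 * (1 - saddlePoint X y)) *
              R ^ (-(1 / 2 : ℝ) + 3 / 2 * (1 - saddlePoint X y)) *
              (X ^ saddlePoint X y * (smoothZeta (saddlePoint X y) y / Real.sqrt (saddlePhi₂ (saddlePoint X y) y))) +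
            164 * (1 + Real.log X) ^ 2 * (y : ℝ) ^ 2 * X ^ (9 / 10 : ℝ) + 64 * X / R ^ 3 + 1) * (∑' ℓ : ℤ, ‖c ℓ‖) +
          48 * (X ^ saddlePoint X y * (smoothZeta (saddlePoint X y) y / Real.sqrt (saddlePhi₂ (saddlePoint X y) y))) *
            profileNorm c / R ^ 3 := by
  obtain ⟨C, x₀, hC, hodd⟩ := norm_classProfileSum_odd_le_of_minor_card
  obtain ⟨x₁, hcard⟩ := card_smoothNumbersUpTo_le_three_mul_saddleSize
  refine ⟨C, max x₀ x₁, hC, fun X y hX hy8 hylog hy80 R hR1 hRX c hc θ hminor => ?_⟩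
  have hx₀ : x₀ ≤ X := le_trans (le_max_left _ _) hX
  have hx₁ : x₁ ≤ X := le_trans (le_max_right _ _) hX
  have hR0 : 0 < R := by linarith
  refine (hodd X y hx₀ hy8 hylog hy80 R hR1 hRX c hc θ hminor).trans (add_le_add le_rfl ?_)
  have h3 := hcard X y hx₁ hy8 hylog X le_rfl
  rw [div_le_div_iff_of_pos_right (pow_pos hR0 3)]
  exact mul_le_mul_of_nonneg_right (by linarith) (profileNorm_nonneg c)

end SmoothArcs

end Literature.NumberTheory.Sieve

end
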